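import Summits.QuantumFields.YangMills.Theorems.FluctuationComparisonRegPrIntLS2BetaChartReadDerivBkgLipschitzKStep
import Summits.QuantumFields.YangMills.Theorems.FluctuationComparisonRegPrIntLS2BetaRegaugedTranslateTower
import Summits.QuantumFields.YangMills.Theorems.FluctuationComparisonRegPrIntLS2BetaChartReadDerivBkgLipschitzFree
import Summits.QuantumFields.YangMills.Theorems.FluctuationComparisonRegPrIntLS2BetaChartReadDerivCovariantTranslation
import HarnessLib

/-!
# S2β · (REG-UP)′ bridge (O2-b4) — «hDcov CLOSED»: the covariant-translation letter of ✓p840162 `…CovariantOscillationKUniform` on the towers `F.P K` with BOTH displayed letters of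
# ✓p840562 `hDcov_of_letters` INHABITED — `hline` by ✓p840574 and `hLip` by the k-step background-Lipschitz letter (✓β3c `norm_fderiv_chartRead_iter_sub_le`) fed per level by
# ✓p840591 (β2, one step, no gauge hypothesis) with the `η_i` letter of ✓β3a; what stays displayed are the (0.4) loop guards `α`, the BKG plaquette classes `δ`, the line recursion `ε`
# and the chart windows — NO derivative letter

Cell `ym3-torus` (YM ladder rung R3 = continuum `SU(2)` Yang–Mills on the three-torus at fixed lattice data — a RUNG: NOT d = 4, NOT infinite volume, NOT a mass gap,
NOT Clay).  Width seat «width 12» `ym3-torus-px12` (gen 27); crux `stmt-QuantumFields-20520`, LINE g18-1 S2β, node (REG-UP)′ (hDcov assembly — the knot).  `--kind proof --supports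
stmt-QuantumFields-20520 --as helper`, count-neutral, DEFINITION-FREE (0 `def`, 0 `instance`, 0 `notation`, 0 `sorry`, default heartbeats).  `SU(N)`, `T3Family` towers `F.P K`, `k + 1 ≤ m + K`.

WHAT IS PROVED (sorry-free).  §1 `scale_update_pow` (`L^{k−l} e_μ = scale (L^{k−l−1} e_μ)`), ★`iter_regaugedTranslate_eq_translate` (`Ū^l(h•τU₀) = h_l • τ_{scale a_l}(Ū^lU₀)`),
★`loopGuard_regaugedTranslate` (the loop guards of the tower of `U′ = h•τ_{L^k e_μ}U₀` ARE those of `U₀`'s: covariance + equivariance + lit ✓`loopHol_translate`), `norm_covTranslate_le` (`‖Y′‖ ≤ ‖X‖`);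
§2 ★★`hdiff_of_classes` — the per-level one-step defects `β_i = 2·67ℓ(κ_i + (κ_i + η_i))∕a` (`κ_i = (d−1)2L·δ_i`, `η_i = L^{k−i}(2ε_i + δ_i)`) from ✓p840591 ∘ ✓β3a; ★★`hLip_regaugedTranslate` —
the `hLip` letter of ✓p840562 INHABITED (✓β3c at `(U₀, U′)`); §3 ★★★**`hDcov_closed`** — `‖↑Ū⟨ȳ,μ⟩·↑(D^{U₀}_k X ⟨ȳ.shift μ, κ⟩)·↑Ū⟨ȳ,μ⟩⋆ − ↑(D^{U₀}_k Y′ ⟨ȳ,κ⟩)‖ ≤ 2·ε_k·(Λ·L^k·‖X‖) +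
(Σ_{i<k} Λ·L^{k−1−i}·(β_i·(Λ·L^i)))·‖X‖`, `Λ = (1+4(d+2))·exp(C·Σ_{j<k} α_j)`.

HONEST SCOPE.  A knot over landed letters; nothing of Bałaban's renormalisation-group analysis proved ([Balaban1985Averaging] Prop. 4 (128)–(131) pp.37–38 is the printed locus of hDcov); the (0.4)
guards, the BKG classes `δ`, the line recursion `ε` (✓p840574: `ε_0 = 0`, `L·ε_i + 2α_i ≤ ε_{i+1}`) and the windows are HYPOTHESES; K-uniformity of the right-hand side is the consumer's arithmetic
on `α_i, δ_i ~ L^{2i}η²` (top-dominated geometric sums); (hNL)∕(REG-UP)′ assembly∕GAP♯∘ (`stub_uniformFibreGapOrbit`, registry 3732b7df UNTOUCHED, 0∕5), the five registered stubs, S2β, crux 20520,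
19936, 19200, `YM3TorusSU2` — NOT proved; rung R3 — NOT d = 4, NOT infinite volume, NOT a mass gap, NOT Clay; the Yang–Mills mass gap is NOT proved.
-/

set_option autoImplicit false

noncomputable section

open scoped Matrix.Norms.L2Operator Topology
open Filter Set Function

namespace Summit.QuantumFields.YangMills.Theorems.FluctuationComparisonRegPrIntLS2BetaChartReadDerivCovariantTranslationClosed

open Literature.MathematicalPhysics.QuantumFieldTheory.Balaban1983to89
open Literature.MathematicalPhysics.QuantumFieldTheory.Balaban1983to89.HaarExponentialChart
open Literature.MathematicalPhysics.QuantumFieldTheory.Balaban1983to89.HaarExponentialChart.IsChartRep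
open Literature.MathematicalPhysics.QuantumFieldTheory.Balaban1983to89.BlockAveraging (Small Idx avgFun loopHol blockAvg blockAvg_avg loopHol_translate)
open Literature.MathematicalPhysics.QuantumFieldTheory.Balaban1983to89.ExpMeanLog (expMeanLogSU deltaSU)
open Literature.MathematicalPhysics.QuantumFieldTheory.Balaban1983to89.Node00
open Literature.MathematicalPhysics.QuantumFieldTheory.Balaban1983to89.T3ContinuumYM3Torus
open Literature.MathematicalPhysics.QuantumFieldTheory.Balaban1983to89.T4Continuum (transfUp iter_gaugeAct)
open Literature.MathematicalPhysics.QuantumFieldTheory.Balaban1983to89.T4UndoubledRP (zero_shift_eq scaleTo_update scale_update)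
open Literature.MathematicalPhysics.QuantumFieldTheory.Balaban1983to89.B10Eq47AxialChi (shiftN rowProd)
open Summit.QuantumFields.YangMills.BalabanUVNodes.N09ChartReadAveragingSmooth
open Summit.QuantumFields.YangMills.Theorems.FluctuationComparisonRegPrIntLS2BetaChartReadGaugeCovariance (conj_mem_lie dist1_loopHol_gaugeAct)
open Summit.QuantumFields.YangMills.Theorems.FluctuationComparisonRegPrIntLS2BetaChartReadIterTranslate (iter_blockAvg_translate)
open Summit.QuantumFields.YangMills.Theorems.FluctuationComparisonRegPrIntLS2BetaChartReadDerivKStepSup (norm_fderiv_chartRead_iter_apply_le_exp)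
open Summit.QuantumFields.YangMills.Theorems.FluctuationComparisonRegPrIntLS2BetaAveragedBondStraightWord (norm_coe_iter_sub_coe_transfUp_rowProd_le)
open Summit.QuantumFields.YangMills.Theorems.FluctuationComparisonRegPrIntLS2BetaRegaugedTranslateTower (scaleTo_update_pow_sub norm_coe_iter_regaugedTranslate_sub_le)
open Summit.QuantumFields.YangMills.Theorems.FluctuationComparisonRegPrIntLS2BetaChartReadDerivBkgLipschitzFree (norm_conjField_le norm_fderiv_chartRead_sub_fderiv_le_of_plaqSmall)
open Summit.QuantumFields.YangMills.Theorems.FluctuationComparisonRegPrIntLS2BetaChartReadDerivCovariantTranslation (hDcov_of_letters)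
open Summit.QuantumFields.YangMills.Theorems.FluctuationComparisonRegPrIntLS2BetaChartReadDerivBkgLipschitzKStep (norm_fderiv_chartRead_iter_sub_le)

variable {N : ℕ} [NeZero N] (F : T3Family)

/-! ## §1 The tower of the re-gauged translate: guards and sizes -/

/-- `L^{k−l}·e_μ = scale (L^{k−l−1}·e_μ)` at level `l < k`. [cite: Balaban1987RG1, (0.1) p.252] -/
theorem scale_update_pow {K k l : ℕ} (hlk : l < k) (μ : Fin (F.P K).d) :
    Site.scale (Function.update (0 : Site (F.P K) (l + 1)) μ (((F.P K).L ^ (k - l - 1) : ℕ) : ZMod ((F.P K).sitesPerDir (l + 1)))) =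
      Function.update (0 : Site (F.P K) l) μ (((F.P K).L ^ (k - l) : ℕ) : ZMod ((F.P K).sitesPerDir l)) := by
  rw [scale_update, ← pow_succ, show k - l - 1 + 1 = k - l by omega]

/-- ★ `Ū^l(h•τ_{L^k e_μ}U₀) = h_l • τ_{scale (L^{k−l−1}e_μ)}(Ū^lU₀)` (`l < k`, `l ≤ m + K`). [cite: Balaban1985Averaging, (11) p.19; Balaban1987RG1, (2.17) p.269] -/
theorem iter_regaugedTranslate_eq_translate {K k l : ℕ} (hlk : l < k) (hl : l ≤ (F.P K).m + (F.P K).K) (U₀ : GaugeField (F.P K) 0 (SU N)) (h : GaugeTransf (F.P K) 0 (SU N)) (μ : Fin (F.P K).d) :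
    Averaging.iter (fun i => blockAvg (P := F.P K) (j := i) (expMeanLogSU (n := Fin N))) l (GaugeField.gaugeAct h (U₀.translate (Site.scaleTo k ((0 : Site (F.P K) k).shift μ)))) =
      GaugeField.gaugeAct (transfUp h l)
        ((Averaging.iter (fun i => blockAvg (P := F.P K) (j := i) (expMeanLogSU (n := Fin N))) l U₀).translate (Site.scale (Function.update (0 : Site (F.P K) (l + 1)) μ (((F.P K).L ^ (k - l - 1) : ℕ) : ZMod ((F.P K).sitesPerDir (l + 1)))))) := by
  rw [iter_gaugeAct _ h l hl, ← scaleTo_update_pow_sub μ hlk.le, iter_blockAvg_translate, scale_update_pow F hlk]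

/-- ★ **THE LOOP GUARDS OF THE TOWER OF `U′ = h•τ_{L^k e_μ}U₀` ARE THOSE OF `U₀`'s** (`l < k`, `l ≤ m + K`). [cite: Balaban1985Averaging, (11)-(13) p.19; Balaban1987RG1, (0.4), (2.17)] -/
theorem loopGuard_regaugedTranslate {K k : ℕ} (hk : k ≤ (F.P K).m + (F.P K).K) (U₀ : GaugeField (F.P K) 0 (SU N)) (h : GaugeTransf (F.P K) 0 (SU N)) (μ : Fin (F.P K).d)
    {α : ℕ → ℝ} (hαU : (∀ l, l < k → ∀ (c : PBond (F.P K) (l + 1)) (idx : Idx (F.P K)), dist1 (loopHol (Averaging.iter (fun i => blockAvg (P := F.P K) (j := i) (expMeanLogSU (n := Fin N))) l U₀) c idx) ≤ α l)) :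
    (∀ l, l < k → ∀ (c : PBond (F.P K) (l + 1)) (idx : Idx (F.P K)), dist1 (loopHol (Averaging.iter (fun i => blockAvg (P := F.P K) (j := i) (expMeanLogSU (n := Fin N))) l (GaugeField.gaugeAct h (U₀.translate (Site.scaleTo k ((0 : Site (F.P K) k).shift μ))))) c idx) ≤ α l) := by
  intro l hl c idx
  rw [iter_regaugedTranslate_eq_translate F hl (by omega) U₀ h μ, dist1_loopHol_gaugeAct, loopHol_translate]
  exact hαU l hl _ idx

/-- `‖Y′‖ ≤ ‖X‖` for the covariant translate `Y′ b := Ad_{h(b₋)} X(b + L^k e_μ)`. [folklore] -/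
theorem norm_covTranslate_le {K k : ℕ} (U₀ : GaugeField (F.P K) 0 (SU N)) (μ : Fin (F.P K).d) (X : PBond (F.P K) 0 → (specialUnitaryLogChart (Fin N)).lie) :
    ‖(fun b : PBond (F.P K) 0 => (⟨((rowProd U₀ b.src μ ((F.P K).L ^ k) : SU N) : Matrix (Fin N) (Fin N) ℂ) * ((X (b.translate (Site.scaleTo k ((0 : Site (F.P K) k).shift μ))) : (specialUnitaryLogChart (Fin N)).lie) : Matrix (Fin N) (Fin N) ℂ) * star ((rowProd U₀ b.src μ ((F.P K).L ^ k) : SU N) : Matrix (Fin N) (Fin N) ℂ), conj_mem_lie (rowProd U₀ b.src μ ((F.P K).L ^ k)) (X (b.translate (Site.scaleTo k ((0 : Site (F.P K) k).shift μ))))⟩ : (specialUnitaryLogChart (Fin N)).lie))‖ ≤ ‖X‖ := by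
  refine (norm_conjField_le (fun x : Site (F.P K) 0 => rowProd U₀ x μ ((F.P K).L ^ k)) (fun b => X (b.translate (Site.scaleTo k ((0 : Site (F.P K) k).shift μ))))).trans ?_
  exact (pi_norm_le_iff_of_nonneg (norm_nonneg X)).2 fun b => norm_le_pi_norm X _

/-! ## §2 The per-level defects and the `hLip` letter -/

/-- ★★ **THE PER-LEVEL ONE-STEP DEFECTS** `β_i = 2·67ℓ(κ_i + (κ_i + η_i))∕a` of the pair (`Ū^iU₀`, `Ū^iU′`) from the BKG class `δ_i` and the `η_i` letter (✓p840591 ∘ ✓β3a). [cite: Balaban1985Averaging, pp.24-25, Prop. 3 (121)-(125) p.36; Balaban1987RG1, (0.4) p.253] -/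
theorem hdiff_of_classes {K k : ℕ} (hk1 : k + 1 ≤ F.m + K) (U₀ : GaugeField (F.P K) 0 (SU N)) (μ : Fin (F.P K).d)
    {α δ ε : ℕ → ℝ} {ρ a : ℝ} (hα24 : ∀ l, α l ≤ 1 / 24) (hαδ : ∀ l, α l < deltaSU (Fin N))
    (hαU : (∀ l, l < k → ∀ (c : PBond (F.P K) (l + 1)) (idx : Idx (F.P K)), dist1 (loopHol (Averaging.iter (fun i => blockAvg (P := F.P K) (j := i) (expMeanLogSU (n := Fin N))) l U₀) c idx) ≤ α l))
    (hρ0 : 0 < ρ) (hρ : ρ ≤ innerRadius (specialUnitaryLogChart (Fin N))) (hα4 : ∀ l, 4 * α l ≤ ρ)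
    (hδ0 : ∀ l, 0 ≤ δ l) (hδ : ∀ l, l < k → PlaqSmall (δ l) (Averaging.iter (fun i => blockAvg (P := F.P K) (j := i) (expMeanLogSU (n := Fin N))) l U₀))
    (hε0 : ε 0 = 0) (hε : ∀ i, i < k → ((F.P K).L : ℝ) * ε i + 2 * α i ≤ ε (i + 1))
    (hwin : ∀ i, i < k → 100 * (((((F.P K).d + 2) * (F.P K).L : ℕ) : ℝ) * (((((F.P K).d - 1 : ℕ) : ℝ) * ((2 * (F.P K).L : ℕ) : ℝ) * δ i) + (((((F.P K).d - 1 : ℕ) : ℝ) * ((2 * (F.P K).L : ℕ) : ℝ) * δ i) + ((((F.P K).L ^ (k - i) : ℕ) : ℝ) * (2 * ε i + δ i))))) ≤ ρ)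
    (ha0 : 0 < a) (ha : 100 * (((((F.P K).d + 2) * (F.P K).L : ℕ) : ℝ) * (Real.exp a - 1)) ≤ ρ) :
    ∀ i, i < k → ∀ (Z : PBond (F.P K) i → (specialUnitaryLogChart (Fin N)).lie) (c' : PBond (F.P K) (i + 1)),
      ‖(((fderiv ℝ (fun (B : PBond (F.P K) i → (specialUnitaryLogChart (Fin N)).lie) (c' : PBond (F.P K) (i + 1)) => (isChartRep_specialUnitaryGroup (n := Fin N)).logChart (avgFun (expMeanLogSU (n := Fin N)) (fun c => (isChartRep_specialUnitaryGroup (n := Fin N)).expChart (B c) * (Averaging.iter (fun i => blockAvg (P := F.P K) (j := i) (expMeanLogSU (n := Fin N))) i U₀) c) c' * (avgFun (expMeanLogSU (n := Fin N)) ((Averaging.iter (fun i => blockAvg (P := F.P K) (j := i) (expMeanLogSU (n := Fin N))) i U₀)) c')⁻¹)) 0) Z c' : (specialUnitaryLogChart (Fin N)).lie) : Matrix (Fin N) (Fin N) ℂ) - (((fderiv ℝ (fun (B : PBond (F.P K) i → (specialUnitaryLogChart (Fin N)).lie) (c' : PBond (F.P K) (i + 1)) => (isChartRep_specialUnitaryGroup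 (n := Fin N)).logChart (avgFun (expMeanLogSU (n := Fin N)) (fun c => (isChartRep_specialUnitaryGroup (n := Fin N)).expChart (B c) * (Averaging.iter (fun i => blockAvg (P := F.P K) (j := i) (expMeanLogSU (n := Fin N))) i (GaugeField.gaugeAct (fun x : Site (F.P K) 0 => rowProd U₀ x μ ((F.P K).L ^ k)) (U₀.translate (Site.scaleTo k ((0 : Site (F.P K) k).shift μ))))) c) c' * (avgFun (expMeanLogSU (n := Fin N)) ((Averaging.iter (fun i => blockAvg (P := F.P K) (j := i) (expMeanLogSU (n := Fin N))) i (GaugeField.gaugeAct (fun x : Site (F.P K) 0 => rowProd U₀ x μ ((F.P K).L ^ k)) (U₀.translate (Site.scaleTo k ((0 : Site (F.P K) k).shift μ)))))) c')⁻¹)) 0) Z c' : (specialUnitaryLogChart (Fin N)).lie) : Matrix (Fin N) (Fin N) ℂ)‖ ≤ (2 * (67 * (((((F.P K).d + 2) * (F.P K).L : ℕ) : ℝ) * (((((F.P K).d - 1 : ℕ) : ℝ) * ((2 * (F.P K).L : ℕ) : ℝ) * δ i) + (((((F.P K).d - 1 : ℕ) : ℝ) * ((2 * (F.P K).L : ℕ)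 : ℝ) * δ i) + ((((F.P K).L ^ (k - i) : ℕ) : ℝ) * (2 * ε i + δ i)))))) / a) * ‖Z‖ := by
  intro i hi Z c'
  have hi1 : i + 1 ≤ (F.P K).m + (F.P K).K := by show i + 1 ≤ F.m + K; omega
  have hi2 : i + 2 ≤ (F.P K).m + (F.P K).K := by show i + 2 ≤ F.m + K; omega
  have hθ6 : ∀ l, α l ≤ 1 / 6 := fun l => (hα24 l).trans (by norm_num)
  -- the `η_i` letter (✓β3a), global in `b`
  have hη : ∀ b : PBond (F.P K) i, (blockOf b.src = c'.src ∨ blockOf b.src = c'.tgt) →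
      ‖(((Averaging.iter (fun i => blockAvg (P := F.P K) (j := i) (expMeanLogSU (n := Fin N))) i (GaugeField.gaugeAct (fun x : Site (F.P K) 0 => rowProd U₀ x μ ((F.P K).L ^ k)) (U₀.translate (Site.scaleTo k ((0 : Site (F.P K) k).shift μ))))) b : SU N) : Matrix (Fin N) (Fin N) ℂ) - (((Averaging.iter (fun i => blockAvg (P := F.P K) (j := i) (expMeanLogSU (n := Fin N))) i U₀) b : SU N) : Matrix (Fin N) (Fin N) ℂ)‖ ≤ ((((F.P K).L ^ (k - i) : ℕ) : ℝ) * (2 * ε i + δ i)) := fun b _ =>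
    norm_coe_iter_regaugedTranslate_sub_le U₀ μ hi.le (by show i ≤ F.m + K; omega) hαδ hθ6 hε0
      (fun j hj cc ι => hαU j (by omega) cc ι) (fun j hj => hε j (by omega)) (hδ0 i) (fun q => (hδ i hi q).le) b
  -- the loop guards of both level-`i` fields
  have hαU' := loopGuard_regaugedTranslate F (k := k) (by show k ≤ F.m + K; omega) U₀ (fun x : Site (F.P K) 0 => rowProd U₀ x μ ((F.P K).L ^ k)) μ hαU
  have h := norm_fderiv_chartRead_sub_fderiv_le_of_plaqSmall hi1 hi2 ((Averaging.iter (fun i => blockAvg (P := F.P K) (j := i) (expMeanLogSU (n := Fin N))) i U₀)) ((Averaging.iter (fun i => blockAvg (P := F.P K) (j := i) (expMeanLogSU (n := Fin N))) i (GaugeField.gaugeAct (fun x : Site (F.P K) 0 => rowProd U₀ x μ ((F.P K).L ^ k)) (U₀.translate (Site.scaleTo k ((0 : Site (F.P K) k).shift μ)))))) hρ0 hρ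
    (fun cc ι => hαU i hi cc ι) (fun cc ι => hαU' i hi cc ι) (hα4 i) (hδ0 i) (hδ i hi) c' hη (hwin i hi) ha0 ha Z
  rw [mul_div_right_comm] at h
  exact h

/-- ★★ **THE `hLip` LETTER OF ✓p840562 INHABITED** at the pair (`U′`, `U₀`): `‖↑(D^{U′}_k Y c) − ↑(D^{U₀}_k Y c)‖ ≤ (Σ_{i<k} Λ·L^{k−1−i}·(β_i·(Λ·L^i)))·‖Y‖`. [cite: Balaban1985Averaging, Prop. 4 (128)-(131) pp.37-38; Balaban1987RG1, (0.11) p.253] -/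
theorem hLip_regaugedTranslate {K k : ℕ} (hk1 : k + 1 ≤ F.m + K) (U₀ : GaugeField (F.P K) 0 (SU N)) (μ : Fin (F.P K).d)
    {α δ ε : ℕ → ℝ} {ρ a : ℝ} (hα0 : ∀ l, 0 ≤ α l) (hα24 : ∀ l, α l ≤ 1 / 24) (hαδ : ∀ l, α l < deltaSU (Fin N))
    (hαU : (∀ l, l < k → ∀ (c : PBond (F.P K) (l + 1)) (idx : Idx (F.P K)), dist1 (loopHol (Averaging.iter (fun i => blockAvg (P := F.P K) (j := i) (expMeanLogSU (n := Fin N))) l U₀) c idx) ≤ α l))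
    (hρ0 : 0 < ρ) (hρ : ρ ≤ innerRadius (specialUnitaryLogChart (Fin N))) (hα4 : ∀ l, 4 * α l ≤ ρ)
    (hδ0 : ∀ l, 0 ≤ δ l) (hδ : ∀ l, l < k → PlaqSmall (δ l) (Averaging.iter (fun i => blockAvg (P := F.P K) (j := i) (expMeanLogSU (n := Fin N))) l U₀))
    (hε0 : ε 0 = 0) (hεnn : ∀ i, 0 ≤ ε i) (hε : ∀ i, i < k → ((F.P K).L : ℝ) * ε i + 2 * α i ≤ ε (i + 1))
    (hwin : ∀ i, i < k → 100 * (((((F.P K).d + 2) * (F.P K).L : ℕ) : ℝ) * (((((F.P K).d - 1 : ℕ) : ℝ) * ((2 * (F.P K).L : ℕ) : ℝ) * δ i) + (((((F.P K).d - 1 : ℕ) : ℝ) * ((2 * (F.P K).L : ℕ) : ℝ) * δ i) + ((((F.P K).L ^ (k - i) : ℕ) : ℝ) * (2 * ε i + δ i))))) ≤ ρ)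
    (ha0 : 0 < a) (ha : 100 * (((((F.P K).d + 2) * (F.P K).L : ℕ) : ℝ) * (Real.exp a - 1)) ≤ ρ)
    (Y : PBond (F.P K) 0 → (specialUnitaryLogChart (Fin N)).lie) (c : PBond (F.P K) k) :
    ‖(((fderiv ℝ (fun (A : PBond (F.P K) 0 → (specialUnitaryLogChart (Fin N)).lie) (c : PBond (F.P K) k) => (isChartRep_specialUnitaryGroup (n := Fin N)).logChart (Averaging.iter (fun i => blockAvg (P := F.P K) (j := i) (expMeanLogSU (n := Fin N))) k (fun b => (isChartRep_specialUnitaryGroup (n := Fin N)).expChart (A b) * (GaugeField.gaugeAct (fun x : Site (F.P K) 0 => rowProd U₀ x μ ((F.P K).L ^ k)) (U₀.translate (Site.scaleTo k ((0 : Site (F.P K) k).shift μ)))) b) c * (Averaging.iter (fun i => blockAvg (P := F.P K) (j := i) (expMeanLogSU (n := Fin N))) k (GaugeField.gaugeAct (fun x : Site (F.P K) 0 => rowProd U₀ x μ ((F.P K).L ^ k)) (U₀.translate (Site.scaleTo k ((0 : Site (F.P K) k).shift μ)))) c)⁻¹)) 0) Y c : (specialUnitaryLogChart (Fin N)).lie)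 : Matrix (Fin N) (Fin N) ℂ) - (((fderiv ℝ (fun (A : PBond (F.P K) 0 → (specialUnitaryLogChart (Fin N)).lie) (c : PBond (F.P K) k) => (isChartRep_specialUnitaryGroup (n := Fin N)).logChart (Averaging.iter (fun i => blockAvg (P := F.P K) (j := i) (expMeanLogSU (n := Fin N))) k (fun b => (isChartRep_specialUnitaryGroup (n := Fin N)).expChart (A b) * U₀ b) c * (Averaging.iter (fun i => blockAvg (P := F.P K) (j := i) (expMeanLogSU (n := Fin N))) k U₀ c)⁻¹)) 0) Y c : (specialUnitaryLogChart (Fin N)).lie) : Matrix (Fin N) (Fin N) ℂ)‖ ≤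
      (∑ i ∈ Finset.range k, ((1 + 4 * (((F.P K).d + 2 : ℕ) : ℝ)) * Real.exp ((((F.P K).d + 2 : ℕ) : ℝ) * (422 + 1616 * (((F.P K).d + 2 : ℕ) : ℝ)) * ∑ j ∈ Finset.range k, α j)) * ((F.P K).L : ℝ) ^ (k - 1 - i) * ((2 * (67 * (((((F.P K).d + 2) * (F.P K).L : ℕ) : ℝ) * (((((F.P K).d - 1 : ℕ) : ℝ) * ((2 * (F.P K).L : ℕ) : ℝ) * δ i) + (((((F.P K).d - 1 : ℕ) : ℝ) * ((2 * (F.P K).L : ℕ) : ℝ) * δ i) + ((((F.P K).L ^ (k - i) : ℕ) : ℝ) * (2 * ε i + δ i)))))) / a) * (((1 + 4 * (((F.P K).d + 2 : ℕ) : ℝ)) * Real.exp ((((F.P K).d + 2 : ℕ) : ℝ) * (422 + 1616 * (((F.P K).d + 2 : ℕ) : ℝ)) * ∑ j ∈ Finset.range k, α j)) * ((F.P K).L : ℝ) ^ i))) * ‖Y‖ := by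
  have hβ0 : ∀ l, 0 ≤ (2 * (67 * (((((F.P K).d + 2) * (F.P K).L : ℕ) : ℝ) * (((((F.P K).d - 1 : ℕ) : ℝ) * ((2 * (F.P K).L : ℕ) : ℝ) * δ l) + (((((F.P K).d - 1 : ℕ) : ℝ) * ((2 * (F.P K).L : ℕ) : ℝ) * δ l) + ((((F.P K).L ^ (k - l) : ℕ) : ℝ) * (2 * ε l + δ l)))))) / a) := fun l => by
    have := hδ0 l; have := hεnn l; positivity
  have hαU' := loopGuard_regaugedTranslate F (k := k) (by show k ≤ F.m + K; omega) U₀ (fun x : Site (F.P K) 0 => rowProd U₀ x μ ((F.P K).L ^ k)) μ hαU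
  rw [norm_sub_rev]
  exact norm_fderiv_chartRead_iter_sub_le F (by omega) U₀ (GaugeField.gaugeAct (fun x : Site (F.P K) 0 => rowProd U₀ x μ ((F.P K).L ^ k)) (U₀.translate (Site.scaleTo k ((0 : Site (F.P K) k).shift μ)))) hα0 hα24 hαδ hβ0 hαU hαU'
    (hdiff_of_classes F hk1 U₀ μ hα24 hαδ hαU hρ0 hρ hα4 hδ0 hδ hε0 hε hwin ha0 ha) Y c

/-! ## §3 hDcov closed -/

/-- ★★★ **hDcov CLOSED** (✓p840162's covariant-translation letter on `F.P K`, second conjunct, with NO derivative letter displayed): under the (0.4) loop guards `α` below `k`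
(`0 ≤ α_l ≤ 1∕24`, `α_l < δ_N`, `4α_l ≤ ρ ≤ innerRadius`), the BKG plaquette classes `PlaqSmall (δ_l) (Ū^lU₀)`, the line recursion `ε` of ✓p840574 and the windows:
**`‖↑Ū⟨ȳ,μ⟩·↑(D^{U₀}_k X ⟨ȳ.shift μ, κ⟩)·↑Ū⟨ȳ,μ⟩⋆ − ↑(D^{U₀}_k Y′ ⟨ȳ,κ⟩)‖ ≤ 2·ε_k·(Λ·L^k·‖X‖) + (Σ_{i<k} Λ·L^{k−1−i}·(β_i·(Λ·L^i)))·‖X‖`**, `Y′ b := Ad_{U₀[b₋,b₋+L^k e_μ]} X(b + L^k e_μ)`,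
`Λ = (1+4(d+2))·exp((d+2)(422+1616(d+2))·Σ_{j<k} α_j)`, `β_i = 2·67ℓ(κ_i + (κ_i + L^{k−i}(2ε_i + δ_i)))∕a`, `κ_i = (d−1)2L·δ_i`. [cite: Balaban1985Averaging, Prop. 4 (128)-(131) pp.37-38, (124)-(125) p.36; Balaban1987RG1, (0.4), (0.11) p.253] -/
theorem hDcov_closed {K k : ℕ} (hk1 : k + 1 ≤ F.m + K) (U₀ : GaugeField (F.P K) 0 (SU N)) (μ : Fin (F.P K).d) (X : PBond (F.P K) 0 → (specialUnitaryLogChart (Fin N)).lie)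
    {α δ ε : ℕ → ℝ} {ρ a : ℝ} (hα0 : ∀ l, 0 ≤ α l) (hα24 : ∀ l, α l ≤ 1 / 24) (hαδ : ∀ l, α l < deltaSU (Fin N))
    (hαU : (∀ l, l < k → ∀ (c : PBond (F.P K) (l + 1)) (idx : Idx (F.P K)), dist1 (loopHol (Averaging.iter (fun i => blockAvg (P := F.P K) (j := i) (expMeanLogSU (n := Fin N))) l U₀) c idx) ≤ α l))
    (hρ0 : 0 < ρ) (hρ : ρ ≤ innerRadius (specialUnitaryLogChart (Fin N))) (hα4 : ∀ l, 4 * α l ≤ ρ)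
    (hδ0 : ∀ l, 0 ≤ δ l) (hδ : ∀ l, l < k → PlaqSmall (δ l) (Averaging.iter (fun i => blockAvg (P := F.P K) (j := i) (expMeanLogSU (n := Fin N))) l U₀))
    (hε0 : ε 0 = 0) (hεnn : ∀ i, 0 ≤ ε i) (hε : ∀ i, i < k → ((F.P K).L : ℝ) * ε i + 2 * α i ≤ ε (i + 1))
    (hwin : ∀ i, i < k → 100 * (((((F.P K).d + 2) * (F.P K).L : ℕ) : ℝ) * (((((F.P K).d - 1 : ℕ) : ℝ) * ((2 * (F.P K).L : ℕ) : ℝ) * δ i) + (((((F.P K).d - 1 : ℕ) : ℝ) * ((2 * (F.P K).L : ℕ) : ℝ) * δ i) + ((((F.P K).L ^ (k - i) : ℕ) : ℝ) * (2 * ε i + δ i))))) ≤ ρ)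
    (ha0 : 0 < a) (ha : 100 * (((((F.P K).d + 2) * (F.P K).L : ℕ) : ℝ) * (Real.exp a - 1)) ≤ ρ)
    (y : Site (F.P K) k) (κ : Fin (F.P K).d) :
    ‖((Averaging.iter (fun i => blockAvg (P := F.P K) (j := i) (expMeanLogSU (n := Fin N))) k U₀ ⟨y, μ⟩ : SU N) : Matrix (Fin N) (Fin N) ℂ) * (((fderiv ℝ (fun (A : PBond (F.P K) 0 → (specialUnitaryLogChart (Fin N)).lie) (c : PBond (F.P K) k) => (isChartRep_specialUnitaryGroup (n := Fin N)).logChart (Averaging.iter (fun i => blockAvg (P := F.P K) (j := i) (expMeanLogSU (n := Fin N))) k (fun b => (isChartRep_specialUnitaryGroup (n := Fin N)).expChart (A b) * U₀ b) c * (Averaging.iter (fun i => blockAvg (P := F.P K) (j := i) (expMeanLogSU (n := Fin N))) k U₀ c)⁻¹)) 0) X ⟨y.shift μ, κ⟩ : (specialUnitaryLogChart (Fin N)).lie) : Matrix (Fin N) (Fin N) ℂ) * star ((Averaging.iter (fun i => blockAvg (P := F.P K) (j := i) (expMeanLogSU (n := Fin N))) k U₀ ⟨y, μ⟩ : SU N)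 : Matrix (Fin N) (Fin N) ℂ) -
        (((fderiv ℝ (fun (A : PBond (F.P K) 0 → (specialUnitaryLogChart (Fin N)).lie) (c : PBond (F.P K) k) => (isChartRep_specialUnitaryGroup (n := Fin N)).logChart (Averaging.iter (fun i => blockAvg (P := F.P K) (j := i) (expMeanLogSU (n := Fin N))) k (fun b => (isChartRep_specialUnitaryGroup (n := Fin N)).expChart (A b) * U₀ b) c * (Averaging.iter (fun i => blockAvg (P := F.P K) (j := i) (expMeanLogSU (n := Fin N))) k U₀ c)⁻¹)) 0) (fun b : PBond (F.P K) 0 => (⟨((rowProd U₀ b.src μ ((F.P K).L ^ k) : SU N) : Matrix (Fin N) (Fin N) ℂ) * ((X (b.translate (Site.scaleTo k ((0 : Site (F.P K) k).shift μ))) : (specialUnitaryLogChart (Fin N)).lie) : Matrix (Fin N) (Fin N) ℂ) * star ((rowProd U₀ b.src μ ((F.P K).L ^ k) : SU N) : Matrix (Fin N) (Fin N) ℂ), conj_mem_lie (rowProd U₀ b.src μ ((F.P K).L ^ k)) (X (b.translate (Site.scaleTo k ((0 : Site (F.P K) k).shift μ))))⟩ : (specialUnitaryLogChart (Fin N)).lie))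 ⟨y, κ⟩ : (specialUnitaryLogChart (Fin N)).lie) : Matrix (Fin N) (Fin N) ℂ)‖ ≤
      2 * ε k * (((1 + 4 * (((F.P K).d + 2 : ℕ) : ℝ)) * Real.exp ((((F.P K).d + 2 : ℕ) : ℝ) * (422 + 1616 * (((F.P K).d + 2 : ℕ) : ℝ)) * ∑ j ∈ Finset.range k, α j)) * ((F.P K).L : ℝ) ^ k * ‖X‖) +
        (∑ i ∈ Finset.range k, ((1 + 4 * (((F.P K).d + 2 : ℕ) : ℝ)) * Real.exp ((((F.P K).d + 2 : ℕ) : ℝ) * (422 + 1616 * (((F.P K).d + 2 : ℕ) : ℝ)) * ∑ j ∈ Finset.range k, α j)) * ((F.P K).L : ℝ) ^ (k - 1 - i) * ((2 * (67 * (((((F.P K).d + 2) * (F.P K).L : ℕ) : ℝ) * (((((F.P K).d - 1 : ℕ) : ℝ) * ((2 * (F.P K).L : ℕ) : ℝ) * δ i) + (((((F.P K).d - 1 : ℕ) : ℝ) * ((2 * (F.P K).L : ℕ) : ℝ) * δ i) + ((((F.P K).L ^ (k - i) : ℕ) : ℝ) * (2 * ε i + δ i)))))) / a) * (((1 + 4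 * (((F.P K).d + 2 : ℕ) : ℝ)) * Real.exp ((((F.P K).d + 2 : ℕ) : ℝ) * (422 + 1616 * (((F.P K).d + 2 : ℕ) : ℝ)) * ∑ j ∈ Finset.range k, α j)) * ((F.P K).L : ℝ) ^ i))) * ‖X‖ := by
  have hkP : k ≤ (F.P K).m + (F.P K).K := by show k ≤ F.m + K; omega
  have hsb : SmallBelow (fun i => blockAvg (P := F.P K) (j := i) (expMeanLogSU (n := Fin N))) k U₀ := fun l hl cc idx => lt_of_le_of_lt (hαU l hl cc idx) (hαδ l)
  have hθ6 : ∀ l, α l ≤ 1 / 6 := fun l => (hα24 l).trans (by norm_num)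
  -- the sup row of `D^{U₀}_k X` (✓(D2))
  have hD : ∀ cc : PBond (F.P K) k, ‖(((fderiv ℝ (fun (A : PBond (F.P K) 0 → (specialUnitaryLogChart (Fin N)).lie) (c : PBond (F.P K) k) => (isChartRep_specialUnitaryGroup (n := Fin N)).logChart (Averaging.iter (fun i => blockAvg (P := F.P K) (j := i) (expMeanLogSU (n := Fin N))) k (fun b => (isChartRep_specialUnitaryGroup (n := Fin N)).expChart (A b) * U₀ b) c * (Averaging.iter (fun i => blockAvg (P := F.P K) (j := i) (expMeanLogSU (n := Fin N))) k U₀ c)⁻¹)) 0) X cc : (specialUnitaryLogChart (Fin N)).lie) : Matrix (Fin N) (Fin N) ℂ)‖ ≤ ((1 + 4 * (((F.P K).d + 2 : ℕ) : ℝ)) * Real.exp ((((F.P K).d + 2 : ℕ) : ℝ) * (422 + 1616 * (((F.P K).d + 2 : ℕ) : ℝ)) * ∑ j ∈ Finset.range k, α j)) * ((F.P K).L : ℝ) ^ k * ‖X‖ := fun cc =>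
    norm_fderiv_chartRead_iter_apply_le_exp (P := F.P K) (N := N) U₀ X hα0 hα24 hαδ k hαU cc
  -- `hline` (✓p840574)
  have hline := fun yy : Site (F.P K) k =>
    norm_coe_iter_sub_coe_transfUp_rowProd_le (P := F.P K) U₀ μ hkP hαδ hθ6 hαU hε0 hε yy
  -- `hLip` (§2), weakened from `‖Y′‖` to `‖X‖`
  have hS0 : 0 ≤ ∑ i ∈ Finset.range k, ((1 + 4 * (((F.P K).d + 2 : ℕ) : ℝ)) * Real.exp ((((F.P K).d + 2 : ℕ) : ℝ) * (422 + 1616 * (((F.P K).d + 2 : ℕ) : ℝ)) * ∑ j ∈ Finset.range k, α j)) * ((F.P K).L : ℝ) ^ (k - 1 - i) * ((2 * (67 * (((((F.P K).d + 2) * (F.P K).L : ℕ) : ℝ) * (((((F.P K).d - 1 : ℕ) : ℝ) * ((2 * (F.P K).L : ℕ) : ℝ) * δ i) + (((((F.P K).d - 1 : ℕ) : ℝ) * ((2 * (F.P K).L : ℕ) : ℝ) * δ i) + ((((F.P K).L ^ (k - i) : ℕ) : ℝ) * (2 * ε i + δ i)))))) / a) * (((1 + 4 * (((F.P K).d + 2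 : ℕ) : ℝ)) * Real.exp ((((F.P K).d + 2 : ℕ) : ℝ) * (422 + 1616 * (((F.P K).d + 2 : ℕ) : ℝ)) * ∑ j ∈ Finset.range k, α j)) * ((F.P K).L : ℝ) ^ i)) :=
    Finset.sum_nonneg fun i _ => by have := hδ0 i; have := hεnn i; positivity
  have hLip : ∀ cc : PBond (F.P K) k,
      ‖(((fderiv ℝ (fun (A : PBond (F.P K) 0 → (specialUnitaryLogChart (Fin N)).lie) (c : PBond (F.P K) k) => (isChartRep_specialUnitaryGroup (n := Fin N)).logChart (Averaging.iter (fun i => blockAvg (P := F.P K) (j := i) (expMeanLogSU (n := Fin N))) k (fun b => (isChartRep_specialUnitaryGroup (n := Fin N)).expChart (A b) * (GaugeField.gaugeAct (fun x : Site (F.P K) 0 => rowProd U₀ x μ ((F.P K).L ^ k)) (U₀.translate (Site.scaleTo k ((0 : Site (F.P K) k).shift μ)))) b) c * (Averaging.iter (fun i => blockAvg (P := F.P K) (j := i) (expMeanLogSU (n := Fin N))) k (GaugeField.gaugeAct (fun x : Site (F.P K) 0 => rowProd U₀ x μ ((F.P K).L ^ k)) (U₀.translate (Site.scaleTo k ((0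 : Site (F.P K) k).shift μ)))) c)⁻¹)) 0) (fun b : PBond (F.P K) 0 => (⟨((rowProd U₀ b.src μ ((F.P K).L ^ k) : SU N) : Matrix (Fin N) (Fin N) ℂ) * ((X (b.translate (Site.scaleTo k ((0 : Site (F.P K) k).shift μ))) : (specialUnitaryLogChart (Fin N)).lie) : Matrix (Fin N) (Fin N) ℂ) * star ((rowProd U₀ b.src μ ((F.P K).L ^ k) : SU N) : Matrix (Fin N) (Fin N) ℂ), conj_mem_lie (rowProd U₀ b.src μ ((F.P K).L ^ k)) (X (b.translate (Site.scaleTo k ((0 : Site (F.P K) k).shift μ))))⟩ : (specialUnitaryLogChart (Fin N)).lie)) cc : (specialUnitaryLogChart (Fin N)).lie) : Matrix (Fin N) (Fin N) ℂ) - (((fderiv ℝ (fun (A : PBond (F.P K) 0 → (specialUnitaryLogChart (Fin N)).lie) (c : PBond (F.P K) k) => (isChartRep_specialUnitaryGroup (n := Fin N)).logChart (Averaging.iter (fun i => blockAvg (P := F.P K) (j := i) (expMeanLogSU (n := Fin N))) k (fun b => (isChartRep_specialUnitaryGroup (n := Fin N)).expChart (A b) * U₀ b) c * (Averaging.iter (fun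 i => blockAvg (P := F.P K) (j := i) (expMeanLogSU (n := Fin N))) k U₀ c)⁻¹)) 0) (fun b : PBond (F.P K) 0 => (⟨((rowProd U₀ b.src μ ((F.P K).L ^ k) : SU N) : Matrix (Fin N) (Fin N) ℂ) * ((X (b.translate (Site.scaleTo k ((0 : Site (F.P K) k).shift μ))) : (specialUnitaryLogChart (Fin N)).lie) : Matrix (Fin N) (Fin N) ℂ) * star ((rowProd U₀ b.src μ ((F.P K).L ^ k) : SU N) : Matrix (Fin N) (Fin N) ℂ), conj_mem_lie (rowProd U₀ b.src μ ((F.P K).L ^ k)) (X (b.translate (Site.scaleTo k ((0 : Site (F.P K) k).shift μ))))⟩ : (specialUnitaryLogChart (Fin N)).lie)) cc : (specialUnitaryLogChart (Fin N)).lie) : Matrix (Fin N) (Fin N) ℂ)‖ ≤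
        (∑ i ∈ Finset.range k, ((1 + 4 * (((F.P K).d + 2 : ℕ) : ℝ)) * Real.exp ((((F.P K).d + 2 : ℕ) : ℝ) * (422 + 1616 * (((F.P K).d + 2 : ℕ) : ℝ)) * ∑ j ∈ Finset.range k, α j)) * ((F.P K).L : ℝ) ^ (k - 1 - i) * ((2 * (67 * (((((F.P K).d + 2) * (F.P K).L : ℕ) : ℝ) * (((((F.P K).d - 1 : ℕ) : ℝ) * ((2 * (F.P K).L : ℕ) : ℝ) * δ i) + (((((F.P K).d - 1 : ℕ) : ℝ) * ((2 * (F.P K).L : ℕ) : ℝ) * δ i) + ((((F.P K).L ^ (k - i) : ℕ) : ℝ) * (2 * ε i + δ i)))))) / a) * (((1 + 4 * (((F.P K).d + 2 : ℕ) : ℝ)) * Real.exp ((((F.P K).d + 2 : ℕ) : ℝ) * (422 + 1616 * (((F.P K).d + 2 : ℕ) : ℝ)) * ∑ j ∈ Finset.range k, α j)) * ((F.P K).L : ℝ) ^ i))) * ‖X‖ := fun cc =>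
    (hLip_regaugedTranslate F hk1 U₀ μ hα0 hα24 hαδ hαU hρ0 hρ hα4 hδ0 hδ hε0 hεnn hε hwin ha0 ha _ cc).trans
      (mul_le_mul_of_nonneg_left (norm_covTranslate_le F U₀ μ X) hS0)
  exact hDcov_of_letters (P := F.P K) U₀ μ hkP hsb X hD hline hLip y κ

end Summit.QuantumFields.YangMills.Theorems.FluctuationComparisonRegPrIntLS2BetaChartReadDerivCovariantTranslationClosed

end
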